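import Mathlib
import Summits.AnomalousDissipation.AnomalousDissipation.Theorems.SoloBlindMarginality
import Summits.AnomalousDissipation.AnomalousDissipation.Theorems.SoloBlindPositivityPersistence

/-!
# SoloBlind — N1 holds on the whole band for every nonnegative nontrivial pattern (paper §24.19 (f-x))

`SoloBlindMarginality` proves the marginality principle N1 for a leaf-amplitude profile that is
strictly positive everywhere; `SoloBlindPositivityPersistence` proves that a nonnegative solution of
the discrete pattern equation `ε² ΔA + W A = 0` is either identically zero or strictly positive
(zero propagation).  Composing the two: for EVERY nonnegative, not identically zero steady pattern the
exact supercriticality `Wᵢ = σ_exact,i − K0` satisfies the form bound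
`Σ Wᵢ φᵢ² ≤ ε² Σ (φᵢ₊₁ − φᵢ)²` for every test profile and the pointwise bound `Wᵢ ≤ 4ε²` at every leaf
of the lattice — loaded or exponentially small, in particular on the whole supercritical band and not
only on the support.  This is what lets the window-avoidance / fat-block / tested-balance chain of
`SoloBlindFloorMechanismII` run on the full band irrespective of where the support sits.

Mathlib + the sibling files only.
-/

namespace Summit.AnomalousDissipation.AnomalousDissipation.Theorems

open Finset

/-- N1, form version, for a nonnegative nontrivial pattern. -/
theorem marginality_form_of_nonneg {N : ℕ} [NeZero N] (A W : ZMod N → ℝ) (ε : ℝ) (hε : ε ≠ 0)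
    (hA : ∀ i, 0 ≤ A i) (hne : ∃ i, A i ≠ 0)
    (heq : ∀ i, ε ^ 2 * lapZ A i + W i * A i = 0) (φ : ZMod N → ℝ) :
    ∑ i, W i * φ i ^ 2 ≤ ε ^ 2 * ∑ i, (φ (i + 1) - φ i) ^ 2 := by
  rcases nonneg_solution_dichotomy ε hε W A hA heq with hpos | hzero
  · exact marginality_form A W ε hpos heq φ
  · obtain ⟨j, hj⟩ := hne
    exact absurd (hzero j) hj

/-- N1, pointwise version, for a nonnegative nontrivial pattern: no leaf of the lattice is more than
`4ε²` supercritical — in particular every leaf of the band, whether or not it carries the pattern. -/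
theorem marginality_of_nonneg {N : ℕ} [NeZero N] (A W : ZMod N → ℝ) (ε : ℝ) (hε : ε ≠ 0)
    (hA : ∀ i, 0 ≤ A i) (hne : ∃ i, A i ≠ 0)
    (heq : ∀ i, ε ^ 2 * lapZ A i + W i * A i = 0) (i : ZMod N) : W i ≤ 4 * ε ^ 2 := by
  rcases nonneg_solution_dichotomy ε hε W A hA heq with hpos | hzero
  · exact marginality_pointwise A W ε hpos heq i
  · obtain ⟨j, hj⟩ := hne
    exact absurd (hzero j) hj

/-- The band corollary in the shape consumed by `offWindow_of_marginal` (`hmarg`): if the exact leaf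
exponent is `σex i = K0 + W i` for the supercriticality `W` of a nonnegative nontrivial pattern, then
`σex i − K0 ≤ 4ε²` at every leaf. -/
theorem supercriticality_le_of_nonneg {N : ℕ} [NeZero N] (A W σex : ZMod N → ℝ) (ε K0 : ℝ)
    (hε : ε ≠ 0) (hA : ∀ i, 0 ≤ A i) (hne : ∃ i, A i ≠ 0)
    (heq : ∀ i, ε ^ 2 * lapZ A i + W i * A i = 0) (hσ : ∀ i, σex i = K0 + W i) (i : ZMod N) :
    σex i - K0 ≤ 4 * ε ^ 2 := by
  have := marginality_of_nonneg A W ε hε hA hne heq i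
  rw [hσ i]; linarith

end Summit.AnomalousDissipation.AnomalousDissipation.Theorems
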